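import Summits.ValiantsHypothesis.ValiantsHypothesis.Theorems.KPlusLogSqLawTridiagonalRealStaticEqualSpeedSteps

/-!
# Route «KPlusLogSqLaw», crux `WeakLifting` (stmt-ValiantsHypothesis-19561) — REAL side of the tridiagonal sector:
# THE EQUAL-SPEED ROW FOR ALL SIZES — on the equal-speed sector of the α register `max Z = m − 1` EXACTLY, for every `m ≥ 1`

HONEST FRAMING.  Helper (`--supports stmt-ValiantsHypothesis-19561 --as helper`), seat val-sym-lift-p2 (g16), cell `pub-symmetroid`,
2026-08-28; α register (static definite symmetric tridiagonal row `B m`).  The EQUAL-SPEED SECTOR = designs whose edge slopes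
`L_t = 2f_t − d_t − d_{t+1}` all have one modulus.  UPPER: `SlopeSumRow.card_posRoots_pathDet_le_of_equalSpeed` (p639113, this seat): `Z ≤ m − 1`, all `m`.
LOWER (this file, all `m`): the ALTERNATING EQUAL-SPEED FAMILY — diagonal `X` (`a ≡ 1`, `d ≡ 1`), links `b_t X^{f_t}` with `f_t = 2, 0, 2, 0, …` (slopes
`+2, −2, +2, …`) and POSITIVE coefficients `b_t` chosen inductively small — has a determinant alternating in sign along `m` positive points, hence
`Z ≥ m − 1`; so **`exists_equalSpeed_card_eq`: for every `m ≥ 1` some definite irreducible equal-speed design has EXACTLY `m − 1` distinct positive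
determinant zeros** — the register restricted to the equal-speed sector is exactly linear with slope ONE (the located full register: `2m − 3` for
`5 ≤ m ≤ 7`).  Mechanism (`equalSpeed_state`, induction on odd sizes with the two fixed-slope steps of `…EqualSpeedSteps`): the state for
`(q, p) = (D_{2j}, D_{2j+1})` is a sign chain of `2j+1` points for `p` plus `deg p = deg q + 1`, `p = X·p₁` with `p₁(0) ≠ 0`, `lc p ~ lc q`, `p(last) ~ lc p`,
`p(first) ~ p₁(0)`; a `+∞` step (`D_{2j+2} = X·p − b²X⁴·q`) and a `0⁺` step (`D_{2j+3} = X·D_{2j+2} − b′²·p`) each add one point.  Explicit instances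
`m ≤ 9` with `b_t = 2^{−T_{t+1}}` are `…TridiagonalRealStaticEqualSpeedSharp` (p641766).  Nothing here is an upper bound beyond p639113; nothing bears on
`WeakLifting` / `TropicalB` (stmt-19771) in their windows, on Conjecture B, on the Door-A registers, on `MatrixDescartes` (stmt-ValiantsHypothesis-18050) or
on VP ≠ VNP.  [this seat's family and induction; folklore: continuants, intermediate values]
-/

set_option linter.dupNamespace false
set_option autoImplicit false

namespace Summit.ValiantsHypothesis.ValiantsHypothesis.Theorems.KPlusLogSqLaw

namespace SlopeSumRow

open Polynomial Finset Filter Topology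
open Summit.ValiantsHypothesis.ValiantsHypothesis.Theorems.KPlusLogSqLaw.StaticTridiagonalRealPotential
  (pathDet pathDet_zero pathDet_one pathDet_add_two pathDet_congr)
open Summit.ValiantsHypothesis.ValiantsHypothesis.Theorems.KPlusLogSqLaw.StaticTridiagonalRealLadder
  (le_card_posRoots_of_isChain isChain_alt_congr)
open Summit.ValiantsHypothesis.ValiantsHypothesis.Theorems.LacunarySymmetroidMatrixDescartes.Census
  (mul_neg_of_mul_pos_of_mul_neg mul_neg_of_mul_neg_of_mul_pos)
open Literature.Topology.PlanarFoliations (mul_pos_of_mul_pos_of_mul_pos)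

/-! ## 4. The alternating equal-speed family: recurrence and the induction -/

/-- The recurrence of the family `a ≡ 1`, `d ≡ 1`, `f_t = 2, 0, 2, 0, …`:  `D_{n+2} = X·D_{n+1} − b_n²·X^{2f_n}·D_n`. [bookkeeping] -/
theorem pathDet_equalSpeed_add_two (b : ℕ → ℝ) (n : ℕ) :
    (pathDet (fun _ : ℕ => (1 : ℝ)) (fun _ : ℕ => (1 : ℕ)) b (fun t : ℕ => if t % 2 = 0 then (2 : ℕ) else 0) (n + 2)) = X * (pathDet (fun _ : ℕ => (1 : ℝ)) (fun _ : ℕ => (1 : ℕ)) b (fun t : ℕ => if t % 2 = 0 then (2 : ℕ) else 0) (n + 1)) - C (b n ^ 2) * X ^ (2 * (if n % 2 = 0 then (2 : ℕ) else 0)) * (pathDet (fun _ : ℕ => (1 : ℝ)) (fun _ : ℕ => (1 : ℕ)) b (fun t : ℕ => if t % 2 = 0 then (2 : ℕ) else 0) (n)) := by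
  rw [pathDet_add_two]
  have e : (C (b n) * (X : ℝ[X]) ^ (if n % 2 = 0 then (2 : ℕ) else 0)) ^ 2 =
      C (b n ^ 2) * X ^ (2 * (if n % 2 = 0 then (2 : ℕ) else 0)) := by
    rw [mul_pow, ← map_pow, ← pow_mul, mul_comm _ 2]
  rw [e, map_one, one_mul, pow_one]

/-- `D_0 = 1`, `D_1 = X` for the family. [bookkeeping] -/
theorem pathDet_equalSpeed_zero_one (b : ℕ → ℝ) : (pathDet (fun _ : ℕ => (1 : ℝ)) (fun _ : ℕ => (1 : ℕ)) b (fun t : ℕ => if t % 2 = 0 then (2 : ℕ) else 0) (0)) = 1 ∧ (pathDet (fun _ : ℕ => (1 : ℝ)) (fun _ : ℕ => (1 : ℕ)) b (fun t : ℕ => if t % 2 = 0 then (2 : ℕ) else 0) (1)) = X := by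
  refine ⟨pathDet_zero _ _ _ _, ?_⟩
  rw [pathDet_one, map_one, one_mul, pow_one]

/-- The family's continuants up to `k` do not see the links `b_t` with `t + 1 ≥ k`. [bookkeeping] -/
theorem pathDet_equalSpeed_congr {b b' : ℕ → ℝ} {k : ℕ} (h : ∀ t, t + 1 < k → b t = b' t) : (pathDet (fun _ : ℕ => (1 : ℝ)) (fun _ : ℕ => (1 : ℕ)) b (fun t : ℕ => if t % 2 = 0 then (2 : ℕ) else 0) (k)) = (pathDet (fun _ : ℕ => (1 : ℝ)) (fun _ : ℕ => (1 : ℕ)) b' (fun t : ℕ => if t % 2 = 0 then (2 : ℕ) else 0) (k)) :=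
  pathDet_congr (fun _ _ => rfl) (fun _ _ => rfl) h (fun _ _ => rfl)

/-- **THE INDUCTION (odd sizes).**  For every `j` there are positive links `b` such that, with `p = D_{2j+1}`, `q = D_{2j}` of the alternating equal-speed family:
`p` alternates in sign along a chain of `2j + 1` positive points, and the state needed for two more steps holds (`deg p = deg q + 1`, `p = X·p₁` with `p₁(0) ≠ 0`,
`lc p ~ lc q`, `p(last) ~ lc p`, `p(first) ~ p₁(0)`). [this file] -/
theorem equalSpeed_state (j : ℕ) : ∃ (b : ℕ → ℝ) (x₀ : ℝ) (L₀ : List ℝ) (p₁ : ℝ[X]),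
    (∀ t, 0 < b t) ∧ (pathDet (fun _ : ℕ => (1 : ℝ)) (fun _ : ℕ => (1 : ℕ)) b (fun t : ℕ => if t % 2 = 0 then (2 : ℕ) else 0) (2 * j)) ≠ 0 ∧
    ((pathDet (fun _ : ℕ => (1 : ℝ)) (fun _ : ℕ => (1 : ℕ)) b (fun t : ℕ => if t % 2 = 0 then (2 : ℕ) else 0) (2 * j + 1))).natDegree = ((pathDet (fun _ : ℕ => (1 : ℝ)) (fun _ : ℕ => (1 : ℕ)) b (fun t : ℕ => if t % 2 = 0 then (2 : ℕ) else 0) (2 * j))).natDegree + 1 ∧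
    (pathDet (fun _ : ℕ => (1 : ℝ)) (fun _ : ℕ => (1 : ℕ)) b (fun t : ℕ => if t % 2 = 0 then (2 : ℕ) else 0) (2 * j + 1)) = X * p₁ ∧ p₁.eval 0 ≠ 0 ∧
    0 < ((pathDet (fun _ : ℕ => (1 : ℝ)) (fun _ : ℕ => (1 : ℕ)) b (fun t : ℕ => if t % 2 = 0 then (2 : ℕ) else 0) (2 * j + 1))).leadingCoeff * ((pathDet (fun _ : ℕ => (1 : ℝ)) (fun _ : ℕ => (1 : ℕ)) b (fun t : ℕ => if t % 2 = 0 then (2 : ℕ) else 0) (2 * j))).leadingCoeff ∧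
    (x₀ :: L₀).IsChain (· < ·) ∧ (∀ x ∈ x₀ :: L₀, 0 < x) ∧
    (x₀ :: L₀).IsChain (fun x y => ((pathDet (fun _ : ℕ => (1 : ℝ)) (fun _ : ℕ => (1 : ℕ)) b (fun t : ℕ => if t % 2 = 0 then (2 : ℕ) else 0) (2 * j + 1))).eval x * ((pathDet (fun _ : ℕ => (1 : ℝ)) (fun _ : ℕ => (1 : ℕ)) b (fun t : ℕ => if t % 2 = 0 then (2 : ℕ) else 0) (2 * j + 1))).eval y < 0) ∧
    (∀ x ∈ x₀ :: L₀, ((pathDet (fun _ : ℕ => (1 : ℝ)) (fun _ : ℕ => (1 : ℕ)) b (fun t : ℕ => if t % 2 = 0 then (2 : ℕ) else 0) (2 * j + 1))).eval x ≠ 0) ∧ (x₀ :: L₀).length = 2 * j + 1 ∧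
    0 < ((pathDet (fun _ : ℕ => (1 : ℝ)) (fun _ : ℕ => (1 : ℕ)) b (fun t : ℕ => if t % 2 = 0 then (2 : ℕ) else 0) (2 * j + 1))).leadingCoeff * ((pathDet (fun _ : ℕ => (1 : ℝ)) (fun _ : ℕ => (1 : ℕ)) b (fun t : ℕ => if t % 2 = 0 then (2 : ℕ) else 0) (2 * j + 1))).eval ((x₀ :: L₀).getLast (List.cons_ne_nil _ _)) ∧
    0 < p₁.eval 0 * ((pathDet (fun _ : ℕ => (1 : ℝ)) (fun _ : ℕ => (1 : ℕ)) b (fun t : ℕ => if t % 2 = 0 then (2 : ℕ) else 0) (2 * j + 1))).eval x₀ := by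
  induction j with
  | zero =>
    refine ⟨fun _ => 1, 1, [], 1, fun _ => one_pos, ?_⟩
    obtain ⟨h0, h1⟩ := pathDet_equalSpeed_zero_one (fun _ : ℕ => (1 : ℝ))
    simp only [Nat.mul_zero, Nat.zero_add]
    rw [h0, h1]
    refine ⟨one_ne_zero, by simp, by simp, by simp, by simp, List.isChain_singleton _, by simp, List.isChain_singleton _,
      by simp, rfl, by simp, by simp⟩
  | succ j ih =>
    obtain ⟨b, x₀, L₀, p₁, hb, hq0, hdegpq, hpX, hp₁0, hlc, hch, hpos, halt, hne, hlen, hlast, hhead⟩ := ih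
    -- names
    set p : ℝ[X] := (pathDet (fun _ : ℕ => (1 : ℝ)) (fun _ : ℕ => (1 : ℕ)) b (fun t : ℕ => if t % 2 = 0 then (2 : ℕ) else 0) (2 * j + 1)) with hpdef
    set q : ℝ[X] := (pathDet (fun _ : ℕ => (1 : ℝ)) (fun _ : ℕ => (1 : ℕ)) b (fun t : ℕ => if t % 2 = 0 then (2 : ℕ) else 0) (2 * j)) with hqdef
    have hp0 : p ≠ 0 := by
      intro h; have := hne x₀ (by simp); rw [h, eval_zero] at this; exact this rfl
    -- degrees for step A
    have hnXp : (X * p).natDegree = q.natDegree + 2 := by rw [natDegree_X_mul hp0, hdegpq]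
    have hc4q : ∀ c : ℝ, 0 < c → (C c * X ^ 4 * q).natDegree = q.natDegree + 4 := by
      intro c hc
      rw [mul_assoc, natDegree_C_mul hc.ne', natDegree_X_pow_mul 4 hq0, add_comm]
    have hX4q : (X ^ 4 * q).natDegree = q.natDegree + 4 := by rw [natDegree_X_pow_mul 4 hq0, add_comm]
    have hdegA : (X * p).degree < (X ^ 4 * q).degree := degree_lt_degree (by rw [hnXp, hX4q]; omega)
    -- STEP A
    obtain ⟨c, P, hc, hPlast, hP0, hchA, hposA, haltA, hcopyA, hrP, hsgnq⟩ :=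
      step_top p q hq0 hdegA hlc (x₀ :: L₀) (List.cons_ne_nil _ _) hch hpos halt hne hlast
    set r : ℝ[X] := X * p - C c * X ^ 4 * q with hrdef
    have hr0 : r ≠ 0 := by
      intro h; rw [h, eval_zero, zero_mul] at hrP; exact lt_irrefl 0 hrP
    have hnr : r.natDegree = q.natDegree + 4 := by
      rw [hrdef, natDegree_sub_eq_right_of_natDegree_lt (by rw [hnXp, hc4q c hc]; omega), hc4q c hc]
    have hlcr : r.leadingCoeff = -(c * q.leadingCoeff) := by
      rw [hrdef, leadingCoeff_sub_of_degree_lt' (degree_lt_degree (by rw [hnXp, hc4q c hc]; omega))]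
      simp [leadingCoeff_C, mul_assoc]
    set r₁ : ℝ[X] := p₁ - C c * X ^ 2 * q with hr₁def
    have hrX : r = X ^ 2 * r₁ := by rw [hrdef, hr₁def, hpX]; ring
    have hr₁0 : r₁.eval 0 = p₁.eval 0 := by simp [hr₁def]
    -- chain of `r` in the `x₀ :: _` shape
    have hshape : (x₀ :: L₀) ++ [P] = x₀ :: (L₀ ++ [P]) := rfl
    rw [hshape] at hchA hposA haltA
    have hrP' := hrP
    rw [hrX] at haltA hcopyA hrP'
    have hneA : ∀ x ∈ x₀ :: (L₀ ++ [P]), (X ^ 2 * r₁).eval x ≠ 0 := by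
      intro x hx
      rcases List.mem_cons.mp hx with hx | hx
      · rw [hx]; intro h; have := hcopyA x₀ (by simp); rw [h, zero_mul] at this; exact lt_irrefl 0 this
      · rcases List.mem_append.mp hx with hx | hx
        · intro h; have := hcopyA x (by simp [hx]); rw [h, zero_mul] at this; exact lt_irrefl 0 this
        · rw [List.mem_singleton.mp hx]; intro h; rw [h, zero_mul] at hrP'; exact lt_irrefl 0 hrP'
    have hheadA : 0 < p₁.eval 0 * (X ^ 2 * r₁).eval x₀ := by
      have h1 := hcopyA x₀ (by simp)   -- r x₀ ~ p x₀
      exact mul_pos_of_mul_pos_of_mul_pos hhead (by rw [mul_comm]; exact h1)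
    -- STEP B
    obtain ⟨c', Q, hc', hQ0, hQx, hchB, hposB, haltB, hcopyB, hsQ⟩ :=
      step_bot p₁ r₁ hp₁0 x₀ (L₀ ++ [P]) hchA hposA haltA hneA hheadA
    rw [← hrX, ← hpX] at haltB hcopyB hsQ
    set s : ℝ[X] := X * r - C c' * p with hsdef
    -- the new links
    set b' : ℕ → ℝ := fun t => if t < 2 * j then b t else if t = 2 * j then Real.sqrt c else Real.sqrt c' with hb'def
    have hb'pos : ∀ t, 0 < b' t := by
      intro t; simp only [hb'def]
      split_ifs
      · exact hb t
      · exact Real.sqrt_pos.mpr hc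
      · exact Real.sqrt_pos.mpr hc'
    have hagree : ∀ k, k ≤ 2 * j + 1 → (pathDet (fun _ : ℕ => (1 : ℝ)) (fun _ : ℕ => (1 : ℕ)) b' (fun t : ℕ => if t % 2 = 0 then (2 : ℕ) else 0) (k)) = (pathDet (fun _ : ℕ => (1 : ℝ)) (fun _ : ℕ => (1 : ℕ)) b (fun t : ℕ => if t % 2 = 0 then (2 : ℕ) else 0) (k)) := by
      intro k hk
      refine (pathDet_equalSpeed_congr fun t ht => ?_).symm
      simp only [hb'def]; rw [if_pos (by omega)]
    have hq' : (pathDet (fun _ : ℕ => (1 : ℝ)) (fun _ : ℕ => (1 : ℕ)) b' (fun t : ℕ => if t % 2 = 0 then (2 : ℕ) else 0) (2 * j)) = q := hagree _ (by omega)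
    have hp' : (pathDet (fun _ : ℕ => (1 : ℝ)) (fun _ : ℕ => (1 : ℕ)) b' (fun t : ℕ => if t % 2 = 0 then (2 : ℕ) else 0) (2 * j + 1)) = p := hagree _ le_rfl
    have hr' : (pathDet (fun _ : ℕ => (1 : ℝ)) (fun _ : ℕ => (1 : ℕ)) b' (fun t : ℕ => if t % 2 = 0 then (2 : ℕ) else 0) (2 * (j + 1))) = r := by
      rw [show 2 * (j + 1) = 2 * j + 2 by ring, pathDet_equalSpeed_add_two, hp', show 2 * j = 2 * j from rfl, hq']
      have hbj : b' (2 * j) = Real.sqrt c := by simp [hb'def]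
      have hmod : (2 * j) % 2 = 0 := Nat.mul_mod_right 2 j
      rw [hbj, Real.sq_sqrt hc.le, if_pos hmod, hrdef]
    have hs' : (pathDet (fun _ : ℕ => (1 : ℝ)) (fun _ : ℕ => (1 : ℕ)) b' (fun t : ℕ => if t % 2 = 0 then (2 : ℕ) else 0) (2 * (j + 1) + 1)) = s := by
      rw [show 2 * (j + 1) + 1 = (2 * j + 1) + 2 by ring, pathDet_equalSpeed_add_two, show 2 * j + 1 + 1 = 2 * (j + 1) by ring,
        hr', hp']
      have hbj : b' (2 * j + 1) = Real.sqrt c' := by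
        simp only [hb'def]; rw [if_neg (by omega), if_neg (by omega)]
      have hmod : ¬ ((2 * j + 1) % 2 = 0) := by omega
      rw [hbj, Real.sq_sqrt hc'.le, if_neg hmod, mul_zero, pow_zero, mul_one, hsdef]
    -- facts about `s`
    have hnXr : (X * r).natDegree = q.natDegree + 5 := by rw [natDegree_X_mul hr0, hnr]
    have hncp : (C c' * p).natDegree = q.natDegree + 1 := by rw [natDegree_C_mul hc'.ne', hdegpq]
    have hns : s.natDegree = r.natDegree + 1 := by
      rw [hsdef, natDegree_sub_eq_left_of_natDegree_lt (by rw [hnXr, hncp]; omega), hnXr, hnr]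
    have hlcs : s.leadingCoeff = r.leadingCoeff := by
      rw [hsdef, leadingCoeff_sub_of_degree_lt (degree_lt_degree (by rw [hnXr, hncp]; omega))]
      simp
    set s₁ : ℝ[X] := X ^ 2 * r₁ - C c' * p₁ with hs₁def
    have hsX : s = X * s₁ := by rw [hsdef, hs₁def, hrX, hpX]; ring
    have hs₁0 : s₁.eval 0 = -(c' * p₁.eval 0) := by simp [hs₁def]
    have hlcr0 : r.leadingCoeff ≠ 0 := leadingCoeff_ne_zero.mpr hr0
    -- assemble the state for `j + 1`
    refine ⟨b', Q, x₀ :: (L₀ ++ [P]), s₁, hb'pos, ?_, ?_, ?_, ?_, ?_, ?_, ?_, ?_, ?_, ?_, ?_, ?_⟩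
    · rw [hr']; exact hr0
    · rw [hs', hr']; exact hns
    · rw [hs']; exact hsX
    · rw [hs₁0]; exact neg_ne_zero.mpr (mul_ne_zero hc'.ne' hp₁0)
    · rw [hs', hr', hlcs]; exact mul_self_pos.mpr hlcr0
    · exact hchB
    · exact hposB
    · rw [hs']; exact haltB
    · rw [hs']
      intro x hx
      rcases List.mem_cons.mp hx with hx | hx
      · rw [hx]; intro h; rw [h, zero_mul] at hsQ; exact lt_irrefl 0 hsQ
      · intro h; have := hcopyB x hx; rw [h, zero_mul] at this; exact lt_irrefl 0 this
    · simp only [List.length_cons, List.length_append, List.length_nil] at hlen ⊢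
      omega
    · -- last point `P`: `s(P) ~ r(P) ~ lc r = lc s`
      rw [hs', hlcs]
      have hlastP : (Q :: x₀ :: (L₀ ++ [P])).getLast (List.cons_ne_nil _ _) = P := by
        simp
      rw [hlastP]
      have h1 : 0 < s.eval P * r.eval P := hcopyB P (by simp)
      have h2 : r.eval P * q.leadingCoeff < 0 := mul_neg_of_mul_neg_of_mul_pos hrP (by rw [mul_comm]; exact hsgnq)
      have h3 : 0 < r.eval P * r.leadingCoeff := by
        rw [hlcr]
        have : r.eval P * -(c * q.leadingCoeff) = c * (-(r.eval P * q.leadingCoeff)) := by ring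
        rw [this]; exact mul_pos hc (neg_pos.mpr h2)
      rw [mul_comm]; exact mul_pos_of_mul_pos_of_mul_pos h1 h3
    · -- first point `Q`: `s(Q) ≁ p₁(0)`, `s₁(0) = −c'·p₁(0)`
      rw [hs', hs₁0]
      have : -(c' * p₁.eval 0) * s.eval Q = c' * (-(s.eval Q * p₁.eval 0)) := by ring
      rw [this]; exact mul_pos hc' (neg_pos.mpr hsQ)

/-! ## 5. The equal-speed row for all sizes -/

/-- **Odd sizes**: positive links with `Z(D_{2j+1}) ≥ 2j`. [this file] -/
theorem exists_equalSpeed_odd (j : ℕ) : ∃ b : ℕ → ℝ, (∀ t, 0 < b t) ∧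
    2 * j ≤ (((pathDet (fun _ : ℕ => (1 : ℝ)) (fun _ : ℕ => (1 : ℕ)) b (fun t : ℕ => if t % 2 = 0 then (2 : ℕ) else 0) (2 * j + 1))).roots.toFinset.filter (fun x => 0 < x)).card := by
  obtain ⟨b, x₀, L₀, p₁, hb, -, -, -, -, -, hch, hpos, halt, -, hlen, -, -⟩ := equalSpeed_state j
  refine ⟨b, hb, ?_⟩
  have h := le_card_posRoots_of_isChain _ (x₀ :: L₀) hch hpos halt
  rw [hlen] at h
  simpa using h

/-- **Even sizes**: positive links with `Z(D_{2j+2}) ≥ 2j + 1` (one `+∞` step on the odd state). [this file] -/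
theorem exists_equalSpeed_even (j : ℕ) : ∃ b : ℕ → ℝ, (∀ t, 0 < b t) ∧
    2 * j + 1 ≤ (((pathDet (fun _ : ℕ => (1 : ℝ)) (fun _ : ℕ => (1 : ℕ)) b (fun t : ℕ => if t % 2 = 0 then (2 : ℕ) else 0) (2 * j + 2))).roots.toFinset.filter (fun x => 0 < x)).card := by
  obtain ⟨b, x₀, L₀, p₁, hb, hq0, hdegpq, hpX, hp₁0, hlc, hch, hpos, halt, hne, hlen, hlast, -⟩ := equalSpeed_state j
  set p : ℝ[X] := (pathDet (fun _ : ℕ => (1 : ℝ)) (fun _ : ℕ => (1 : ℕ)) b (fun t : ℕ => if t % 2 = 0 then (2 : ℕ) else 0) (2 * j + 1)) with hpdef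
  set q : ℝ[X] := (pathDet (fun _ : ℕ => (1 : ℝ)) (fun _ : ℕ => (1 : ℕ)) b (fun t : ℕ => if t % 2 = 0 then (2 : ℕ) else 0) (2 * j)) with hqdef
  have hp0 : p ≠ 0 := by
    intro h; have := hne x₀ (by simp); rw [h, eval_zero] at this; exact this rfl
  have hnXp : (X * p).natDegree = q.natDegree + 2 := by rw [natDegree_X_mul hp0, hdegpq]
  have hX4q : (X ^ 4 * q).natDegree = q.natDegree + 4 := by rw [natDegree_X_pow_mul 4 hq0, add_comm]
  have hdegA : (X * p).degree < (X ^ 4 * q).degree := degree_lt_degree (by rw [hnXp, hX4q]; omega)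
  obtain ⟨c, P, hc, -, -, hchA, hposA, haltA, -, -, -⟩ :=
    step_top p q hq0 hdegA hlc (x₀ :: L₀) (List.cons_ne_nil _ _) hch hpos halt hne hlast
  set b' : ℕ → ℝ := fun t => if t < 2 * j then b t else Real.sqrt c with hb'def
  have hb'pos : ∀ t, 0 < b' t := by
    intro t; simp only [hb'def]; split_ifs
    · exact hb t
    · exact Real.sqrt_pos.mpr hc
  have hagree : ∀ k, k ≤ 2 * j + 1 → (pathDet (fun _ : ℕ => (1 : ℝ)) (fun _ : ℕ => (1 : ℕ)) b' (fun t : ℕ => if t % 2 = 0 then (2 : ℕ) else 0) (k)) = (pathDet (fun _ : ℕ => (1 : ℝ)) (fun _ : ℕ => (1 : ℕ)) b (fun t : ℕ => if t % 2 = 0 then (2 : ℕ) else 0) (k)) := by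
    intro k hk
    refine (pathDet_equalSpeed_congr fun t ht => ?_).symm
    simp only [hb'def]; rw [if_pos (by omega)]
  have hr' : (pathDet (fun _ : ℕ => (1 : ℝ)) (fun _ : ℕ => (1 : ℕ)) b' (fun t : ℕ => if t % 2 = 0 then (2 : ℕ) else 0) (2 * j + 2)) = X * p - C c * X ^ 4 * q := by
    rw [pathDet_equalSpeed_add_two, hagree _ le_rfl, hagree _ (by omega)]
    have hbj : b' (2 * j) = Real.sqrt c := by simp [hb'def]
    have hmod : (2 * j) % 2 = 0 := Nat.mul_mod_right 2 j
    rw [hbj, Real.sq_sqrt hc.le, if_pos hmod]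
  refine ⟨b', hb'pos, ?_⟩
  rw [hr']
  have h := le_card_posRoots_of_isChain _ ((x₀ :: L₀) ++ [P]) hchA hposA haltA
  simp only [List.length_append, List.length_singleton, hlen] at h
  simpa using h

/-- **THE EQUAL-SPEED ROW IS `m − 1` FOR ALL SIZES.**  For every `m ≥ 1` the alternating equal-speed family (diagonal `X`; links `b_t X^{f_t}`, `f_t = 2, 0, 2, 0, …`,
all edge slopes `±2`) admits POSITIVE links `b` with EXACTLY `m − 1` distinct positive determinant zeros — the maximum allowed by the EQUAL-SPEED LAW
(`card_posRoots_pathDet_le_of_equalSpeed`, p639113) for designs whose edge slopes have one modulus.  So on the equal-speed sector of the α register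
`max Z = m − 1` for every size. [this file] -/
theorem exists_equalSpeed_card_eq (m : ℕ) (hm : 1 ≤ m) : ∃ b : ℕ → ℝ, (∀ t, 0 < b t) ∧
    (((pathDet (fun _ : ℕ => (1 : ℝ)) (fun _ : ℕ => (1 : ℕ)) b (fun t : ℕ => if t % 2 = 0 then (2 : ℕ) else 0) (m))).roots.toFinset.filter (fun x => 0 < x)).card = m - 1 := by
  have hup : ∀ b : ℕ → ℝ, (((pathDet (fun _ : ℕ => (1 : ℝ)) (fun _ : ℕ => (1 : ℕ)) b (fun t : ℕ => if t % 2 = 0 then (2 : ℕ) else 0) (m))).roots.toFinset.filter (fun x => 0 < x)).card ≤ m - 1 := fun b =>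
    card_posRoots_pathDet_le_of_equalSpeed _ _ _ _ m 2 fun t _ => by
      by_cases h : t % 2 = 0
      · left; simp [h]
      · right; simp [h]
  obtain ⟨j, rfl | rfl⟩ := Nat.even_or_odd' m
  · -- `m = 2 j`, `j ≥ 1`
    obtain ⟨i, rfl⟩ : ∃ i, j = i + 1 := ⟨j - 1, by omega⟩
    obtain ⟨b, hb, hlow⟩ := exists_equalSpeed_even i
    refine ⟨b, hb, le_antisymm (hup b) ?_⟩
    have e2 : 2 * (i + 1) - 1 = 2 * i + 1 := by omega
    have e1 : 2 * (i + 1) = 2 * i + 2 := by ring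
    rw [e2, e1]
    exact hlow
  · obtain ⟨b, hb, hlow⟩ := exists_equalSpeed_odd j
    refine ⟨b, hb, le_antisymm (hup b) ?_⟩
    rw [show 2 * j + 1 - 1 = 2 * j by omega]
    exact hlow

end SlopeSumRow

end Summit.ValiantsHypothesis.ValiantsHypothesis.Theorems.KPlusLogSqLaw
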